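import Summits.QuantumFields.YangMills.Theorems.UnitScaleTiltProp7KinvEtaFamilyPackage
import Summits.QuantumFields.YangMills.Theorems.UnitScaleTiltProp7GreenOneBlockFamilyPackage
import Summits.QuantumFields.YangMills.Theorems.UnitScaleTiltProp7KinvSlotOfCone
import HarnessLib

/-!
# Route `UnitScaleTilt`, crux K1 «MinimiserStabilityRegPr» (stmt-QuantumFields-19200), EX face — K-STOREY, FILE (K6-Δ₁ = THE PROJECTED J-SLOT CLOSURE KNIT):
# **THE COARSE ENTRY ROW `hKinv`(Δ₁) OF `K₁⁻¹ = (Q_kG₁Q_k†)⁻¹`, `G₁ = Δ_a(Δ₁ᴾ(T_Jᴾ))⁻¹`, FOR ALL MEMBERS, AS ONE `∃`-PACKAGE** — px10's slot-generic cone ✓`Prop7KinvSlotOfCone.kinvRow_slot_family_of_cone`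
# at `Δx := DeltaOneP … a (TJSlotP … a)` (= `DeltaOnePJ … a`, ✓`DeltaOnePJ_def` `rfl`) fed the η-closure ✓`Prop7KinvEtaFamilyPackage.kinvRow_eta_family_exists`, the J-slot block package
# ✓`Prop7GreenOneBlockFamilyPackage.hGblk_one_family_exists` (its third conjunct: the `G₁ − G₀` block rows, linear in the radius; inside it T3's `PosOnto`(Δ₁ᴾ) and (γ)), and (γ) for `PosOnto`(Δ^η)

Cell `ym3-torus` (HUMAN RULING D-0037; rung R3 = SU(2) YM₃ on T³ — NOT d = 4, NOT infinite volume, NOT a mass gap, NOT Clay).  Width seat `ym3-torus-px12` (gen 18; px10 g14 «K6-Δ₁: YOURS — GO»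
2026-08-30 13:51Z; px10's K6-Π ✓p775669 is the token pattern, `DeltaPiSlotP ↦ DeltaOneP … (TJSlotP …)`).  THEOREMS ONLY (0 `def`, 0 `sorry`); `--supports stmt-QuantumFields-19200 --as helper`; count-neutral.

THE INPUTS, ALL BY NAME.  (K6-η) `kinvRow_eta_family_exists` → `αK CK μK` + the `hKinv`(η) family under `Lift ∧ ROOM ∧ window`; (GJ-PKG) `hGblk_one_family_exists` → `αP CP KP δP` + under the same
thread the block rows of `G₁ − G₀` with constant `α′·KP L` for every radius `0 < α′ ≤ αP L` and `PosOnto`(Δ₁ᴾ) via T3 ✓`hco_DeltaOnePJ_exists`; (γ) ✓`hco_DeltaEtaSlot_exists` + ✓`posOnto_of_coercive` →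
`PosOnto`(Δ^η).  CHOICES (pure reals, K6-Π verbatim): rate `μ L := min (μK L) (δP L∕2)`; cone modulus `M L := CK L·9600e^{2μ L+1}·KP L·(2(1+1∕μ L))³·3(2(1+2∕μ L))³·3(2(1+4∕μ L))³`;
cap `αO L := min (min (min αK αP) (min αco αc)) (M L + 1)⁻¹`, `κ L := αO L·KP L` — so the Neumann window reads `αO·M < 1`; the clamped coupling function and the thread `Lift ∧ ROOM`.
THE ONE DISPLAYED LETTER.  px19's gauge-spike Hessian row family `hqG` (✓`hqG_of_pointwise_identity_and_FR2_family`'s conclusion VERBATIM; suppliers ⟨(2) pointwise, FR₂-lite⟩) — it enters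
through (TDb) inside GJ-PKG; everything else is a tree theorem.
WHAT IS PROVED (ns `Summit.QuantumFields.YangMills.Theorems.Prop7KinvOneFamilyPackage`).
* ★★★ `kinvRow_one_family_exists` — THERE ARE L-only `αO CO μO : ℕ → ℝ` (cap with the three windows of record and `≤ 1`, constant `≥ 0`, rate `> 0`) such that for every `L > 1`, member `i`,
  background `U₀` with `RegPr ρ U₀`, `ρ ≤ αO L`, under `Lift`, `ROOM` and the coupling window: THE DOORS' `hKinv`(Δ₁) TEXT
  `‖toL2B⁻¹(KinvT … a (DeltaOneP … a (TJSlotP … a)) U₀ (toL2B δ_yZ))(y′)‖ ≤ CO L·((c₀ L∕cB L)·ℓ³)·e^{−μO L·tdist(ŷ′, ŷ)}·‖Z‖` — the `hKinv` input of the slot-generic H-DOOR ✓p769611 §4 at `Δ₁ᴾ`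
  (EX row (6) `norm_H₁` VALUE side) and of ✓`kernelC_family_of_kinvRow_of_greenColumn`-type doors at `Δ₁ᴾ`.
* ★★ `kinvRow_one_family_exists'` — the same at `DeltaOnePJ … a` (S47's `norm_G` slot spelling), by `exact`.
HONEST SCOPE.  An `∃`-assembly; no estimate of print is proved HERE; CONDITIONAL on the displayed `hqG`; nothing of `hqG`, `norm_H₁`, `hCk`, EX or the crux is proved; the Yang–Mills mass gap is NOT proved.

References: T. Bałaban, CMP **99** (1985) 389–434 [Balaban1985BackgroundPropagators] ((3.127)–(3.132) pp.421–422, (3.86) p.409, Thm 3.11 p.416); CMP **102** (1985) 277–309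
[Balaban1985Variational] (Thm 1 p.279, (45)–(46) p.285).
-/

set_option autoImplicit false

noncomputable section

open scoped BigOperators Matrix.Norms.L2Operator InnerProductSpace ComplexConjugate

namespace Summit.QuantumFields.YangMills.Theorems.Prop7KinvOneFamilyPackage

open Literature.MathematicalPhysics.QuantumFieldTheory.Balaban1983to89
open Literature.MathematicalPhysics.QuantumFieldTheory.Balaban1983to89.T3ContinuumYM3Torus
open Literature.MathematicalPhysics.QuantumFieldTheory.Balaban1983to89.T3Thm1Carrier
open T3PrintedRegularMinimiser (RegPr)
open T3PrintedMinimiserExistence (regPr_mono)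
open T3PrintedRegularOrbits (sites_eq)
open T3LevelShift (siteShift)
open T3SectALandauChart (bgUnits)
open B15DeterminingSets (embIter)
open B9Eq311L2Pairing (WL2)
open B11Eq103H1Complex (BondL2K)
open B5Eq118OneStroke (iterBlockOf)
open Summit.QuantumFields.YangMills.Theorems.Prop8Chart (emlIterU)
open Summit.QuantumFields.YangMills.Theorems.Prop7SectET3Transport (periodsT3)
open Summit.QuantumFields.YangMills.Theorems.Prop7SectET3HilbertLetters (W₂ toL2 toL2S DL2 toL2B)
open Summit.QuantumFields.YangMills.Theorems.Prop7SectET3WilsonHessian (DeltaEtaSlot)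
open Summit.QuantumFields.YangMills.Theorems.Prop7SectET3CurvedPropagators (GT KinvT PosOnto)
open Summit.QuantumFields.YangMills.Theorems.Prop7SectET3DeltaOne (avgHess)
open Summit.QuantumFields.YangMills.Theorems.Prop7SectET3DeltaOnePInv (DeltaOneP TJSlotP DeltaOnePJ)
open Summit.QuantumFields.YangMills.Theorems.Prop7OneFormCoerciveHolds (hco_DeltaEtaSlot_exists posOnto_of_coercive)
open Summit.QuantumFields.YangMills.Theorems.Prop7Kernel133OfPiBlockLetters (coarseRow_mono_rate)
open Summit.QuantumFields.YangMills.Theorems.Prop7KinvSlotOfCone (kinvRow_slot_family_of_cone)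
open Summit.QuantumFields.YangMills.Theorems.Prop7KinvEtaFamilyPackage (kinvRow_eta_family_exists)
open Summit.QuantumFields.YangMills.Theorems.Prop7GreenOneBlockFamilyPackage (hGblk_one_family_exists)
open Summit.QuantumFields.YangMills.Theorems.Prop7TJSlotCoerciveClosed (hco_DeltaOnePJ_exists)

/-- ★★★ **THE `hKinv`(Δ₁) `∃`-PACKAGE: THE COARSE ENTRY ROW OF `(Q_kG₁Q_k†)⁻¹` FOR ALL MEMBERS WITH L-ONLY CONSTANTS** (cap `αO`, constant `CO L·((c₀ L∕cB L)·ℓ³)`, rate `μO L`; thread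
`Lift ∧ ROOM ∧` coupling window; the gauge-spike Hessian row `hqG` DISPLAYED) — the slot-generic cone ✓`kinvRow_slot_family_of_cone` at `Δx := DeltaOneP … a (TJSlotP … a)` ∘
{✓`kinvRow_eta_family_exists`, ✓`hGblk_one_family_exists` conj 3, T3 `PosOnto`(Δ₁ᴾ), (γ)}, ONE pure-real cap closing the Neumann window.
[cite: Balaban1985BackgroundPropagators, (3.127)–(3.132) pp.421–422, (3.86) p.409; Balaban1985Variational, Thm 1 p.279] -/
theorem kinvRow_one_family_exists [hFL : ∀ F : T3Family, Fact (0 < (F.L : ℝ))] [hFη : ∀ (F : T3Family) (k : ℕ), Fact (0 < ((F.L : ℝ)⁻¹) ^ k)]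
    (c₀ cB : ℕ → ℝ) [hc₀ : ∀ L : ℕ, Fact (0 < c₀ L)] [hcB : ∀ L : ℕ, Fact (0 < cB L)] {a₀ a₁ : ℝ} (ha₀ : 0 < a₀) (ha₀₁ : a₀ ≤ a₁)
    (αq qG : ℕ → ℝ) (hαq : ∀ L : ℕ, 1 < L → 0 < αq L) (hqG : ∀ L : ℕ, 1 < L → 0 ≤ qG L)
    (hqGrow : ∀ (L : ℕ), 1 < L → ∀ (i : Idx L) (U₀ : GaugeField (i.1.1.P i.1.2.2) 0 (Matrix.specialUnitaryGroup (Fin 2) ℂ)), RegPr i.1.1 i.1.2.1 i.1.2.2 (αq L) U₀ →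
      ∀ (X' : PBond (i.1.1.P i.1.2.2) 0 → Matrix (Fin 2) (Fin 2) ℂ) (s : ℝ) (x : Site (i.1.1.P i.1.2.2) 0) (A : Matrix (Fin 2) (Fin 2) ℂ), (∀ b, ‖X' b‖ ≤ s) →
        ∑ y : PBond (i.1.1.P i.1.2.1) 0, ‖avgHess i.1.1 i.1.2.1 i.1.2.2 i.2.2.le U₀ X'
            ((toL2 i.1.1 i.1.2.2 (c₀ L)).symm (DL2 i.1.1 i.1.2.1 i.1.2.2 (c₀ L) U₀ (toL2S i.1.1 i.1.2.2 (c₀ L) (Pi.single x A)))) y‖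
          ≤ qG L * ((L : ℝ) ^ (i.1.2.2 - i.1.2.1))⁻¹ * s * ‖A‖) :
    ∃ (αPi CPi μPi : ℕ → ℝ),
      (∀ L : ℕ, 1 < L → 0 < αPi L) ∧ (∀ L : ℕ, 1 < L → 10 ^ 12 * (L : ℝ) ^ 3 * αPi L ≤ 1) ∧ (∀ L : ℕ, 1 < L → 10 ^ 10 * (L : ℝ) ^ 6 * αPi L ≤ 1) ∧
      (∀ L : ℕ, 1 < L → 13 * 10 ^ 14 * (L : ℝ) ^ 3 * αPi L ≤ 1) ∧ (∀ L : ℕ, 1 < L → αPi L ≤ 1) ∧ (∀ L : ℕ, 1 < L → 0 ≤ CPi L) ∧ (∀ L : ℕ, 1 < L → 0 < μPi L) ∧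
    ∀ (L : ℕ), 1 < L → ∀ (i : Idx L) (U₀ : GaugeField (i.1.1.P i.1.2.2) 0 (Matrix.specialUnitaryGroup (Fin 2) ℂ)), ∀ ρ : ℝ, RegPr i.1.1 i.1.2.1 i.1.2.2 ρ U₀ → ρ ≤ αPi L →
        (∀ cf : Site (i.1.1.P i.1.2.2) (i.1.2.2 - i.1.2.1) → Matrix (Fin 2) (Fin 2) ℂ,
        (∀ e' : PBond (i.1.1.P i.1.2.2) (i.1.2.2 - i.1.2.1), cf e'.src = ((emlIterU (i.1.2.2 - i.1.2.1) (bgUnits i.1.1 i.1.2.2 U₀) e' : (Matrix (Fin 2) (Fin 2) ℂ)ˣ) : Matrix (Fin 2) (Fin 2) ℂ) * cf e'.tgt *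
        (((emlIterU (i.1.2.2 - i.1.2.1) (bgUnits i.1.1 i.1.2.2 U₀) e')⁻¹ : (Matrix (Fin 2) (Fin 2) ℂ)ˣ) : Matrix (Fin 2) (Fin 2) ℂ)) →
        ∃ l₀ : Site (i.1.1.P i.1.2.2) 0 → Matrix (Fin 2) (Fin 2) ℂ,
        (∀ b' : PBond (i.1.1.P i.1.2.2) 0, l₀ b'.src = ((bgUnits i.1.1 i.1.2.2 U₀ b' : (Matrix (Fin 2) (Fin 2) ℂ)ˣ) : Matrix (Fin 2) (Fin 2) ℂ) * l₀ b'.tgt * (((bgUnits i.1.1 i.1.2.2 U₀ b')⁻¹ : (Matrix (Fin 2) (Fin 2) ℂ)ˣ) : Matrix (Fin 2) (Fin 2) ℂ)) ∧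
        ∀ y : Site (i.1.1.P i.1.2.2) (i.1.2.2 - i.1.2.1), l₀ (embIter (i.1.2.2 - i.1.2.1) y) = cf y) →
      2 * (12 * i.1.1.L ^ (i.1.2.2 - i.1.2.1) + 5) ≤ (i.1.1.P i.1.2.2).sitesPerDir 0 →
      ∀ a : ℝ, a₀ * (c₀ L / cB L) * ((i.1.1.L : ℝ) ^ (i.1.2.2 - i.1.2.1)) ^ 3 ≤ a → a ≤ a₁ * (c₀ L / cB L) * ((i.1.1.L : ℝ) ^ (i.1.2.2 - i.1.2.1)) ^ 3 →
      ∀ (y : PBond (i.1.1.P i.1.2.1) 0) (Z : Matrix (Fin 2) (Fin 2) ℂ) (y' : PBond (i.1.1.P i.1.2.1) 0),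
        ‖(toL2B i.1.1 i.1.2.1 (cB L)).symm (KinvT i.1.1 i.1.2.1 i.1.2.2 i.2.2.le (c₀ L) (cB L) a (DeltaOneP i.1.1 i.1.2.1 i.1.2.2 i.2.2.le (c₀ L) (cB L) a (TJSlotP i.1.1 i.1.2.1 i.1.2.2 i.2.2.le (c₀ L) (cB L) a)) U₀
            (toL2B i.1.1 i.1.2.1 (cB L) (Pi.single y Z))) y'‖
          ≤ CPi L * ((c₀ L / cB L) * ((L : ℝ) ^ (i.1.2.2 - i.1.2.1)) ^ 3)
              * Real.exp (-(μPi L * (Site.tdist (siteShift (sites_eq i.1.1 i.1.2.1 i.1.2.2 i.2.2.le) y'.src) (siteShift (sites_eq i.1.1 i.1.2.1 i.1.2.2 i.2.2.le) y.src) : ℝ))) * ‖Z‖ := by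
  classical
  -- the landed ∃-packages
  obtain ⟨αK, CK, μK, hαK, hWK12, hWK10, hWK13, hαK1, hCK, hμK, hKη⟩ := kinvRow_eta_family_exists c₀ cB ha₀ ha₀₁
  obtain ⟨αP, CP, KP, δP, hαP, hWP12, hWP10, hWP13, -, hCP, hKP, hδP, hP⟩ := hGblk_one_family_exists c₀ cB ha₀ ha₀₁ αq qG hαq hqG hqGrow
  obtain ⟨αco, γco, hαco, hWco, hwinco, hγco, hco⟩ := hco_DeltaEtaSlot_exists c₀ cB ha₀
  obtain ⟨αcp, γcp, hαcp, hWcp, hwincp, hγcp, hcp⟩ := hco_DeltaOnePJ_exists c₀ cB ha₀ ha₀₁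
  -- the common rate and the cone modulus
  set μ : ℕ → ℝ := fun L => min (μK L) (δP L / 2) with hμd
  have hμ0 : ∀ L : ℕ, 1 < L → 0 < μ L := fun L hL => by simp only [hμd]; exact lt_min (hμK L hL) (half_pos (hδP L hL))
  have hμK' : ∀ L : ℕ, μ L ≤ μK L := fun L => min_le_left _ _
  have hμδ : ∀ L : ℕ, 1 < L → 2 * μ L ≤ δP L := fun L hL => by have := min_le_right (μK L) (δP L / 2); simp only [hμd]; linarith
  set M : ℕ → ℝ := fun L => CK L * (9600 * Real.exp (2 * μ L + 1) * KP L * (2 * (1 + 1 / μ L)) ^ 3) * (3 * (2 * (1 + 2 / μ L)) ^ 3) * (3 * (2 * (1 + 4 / μ L)) ^ 3) with hMd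
  have hM0 : ∀ L : ℕ, 1 < L → 0 ≤ M L := fun L hL => by
    have := hCK L hL; have := hKP L hL; have := hμ0 L hL; simp only [hMd]; positivity
  -- the cap
  set αPi : ℕ → ℝ := fun L => min (min (min (αK L) (αP L)) (min (αco L) (αcp L))) (M L + 1)⁻¹ with hαPi
  have hαPi0 : ∀ L : ℕ, 1 < L → 0 < αPi L := fun L hL => by
    have := hαK L hL; have := hαP L hL; have := hαco L hL; have := hαcp L hL; have := hM0 L hL
    simp only [hαPi]; exact lt_min (lt_min (lt_min (by assumption) (by assumption)) (lt_min (by assumption) (by assumption))) (by positivity)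
  have hαPiK : ∀ L, αPi L ≤ αK L := fun L => by simp only [hαPi]; exact (min_le_left _ _).trans ((min_le_left _ _).trans (min_le_left _ _))
  have hαPiP : ∀ L, αPi L ≤ αP L := fun L => by simp only [hαPi]; exact (min_le_left _ _).trans ((min_le_left _ _).trans (min_le_right _ _))
  have hαPico : ∀ L, αPi L ≤ αco L := fun L => by simp only [hαPi]; exact (min_le_left _ _).trans ((min_le_right _ _).trans (min_le_left _ _))
  have hαPicp : ∀ L, αPi L ≤ αcp L := fun L => by simp only [hαPi]; exact (min_le_left _ _).trans ((min_le_right _ _).trans (min_le_right _ _))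
  have hαPiM : ∀ L, αPi L ≤ (M L + 1)⁻¹ := fun L => by simp only [hαPi]; exact min_le_right _ _
  have hW12 : ∀ L : ℕ, 1 < L → 10 ^ 12 * (L : ℝ) ^ 3 * αPi L ≤ 1 := fun L hL => by
    have hL0 : (0 : ℝ) < L := by exact_mod_cast lt_trans zero_lt_one hL
    exact (mul_le_mul_of_nonneg_left (hαPiK L) (by positivity)).trans (hWK12 L hL)
  have hW10 : ∀ L : ℕ, 1 < L → 10 ^ 10 * (L : ℝ) ^ 6 * αPi L ≤ 1 := fun L hL => by
    have hL0 : (0 : ℝ) < L := by exact_mod_cast lt_trans zero_lt_one hL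
    exact (mul_le_mul_of_nonneg_left (hαPiK L) (by positivity)).trans (hWK10 L hL)
  have hW13 : ∀ L : ℕ, 1 < L → 13 * 10 ^ 14 * (L : ℝ) ^ 3 * αPi L ≤ 1 := fun L hL => by
    have hL0 : (0 : ℝ) < L := by exact_mod_cast lt_trans zero_lt_one hL
    exact (mul_le_mul_of_nonneg_left (hαPiK L) (by positivity)).trans (hWK13 L hL)
  -- the cone window `αPi·M < 1`
  have hwin : ∀ L : ℕ, 1 < L → CK L * (9600 * Real.exp (2 * μ L + 1) * (αPi L * KP L) * (2 * (1 + 1 / μ L)) ^ 3) * (3 * (2 * (1 + 2 / μ L)) ^ 3) * (3 * (2 * (1 + 4 / μ L)) ^ 3) < 1 := by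
    intro L hL
    have hM := hM0 L hL
    have e : CK L * (9600 * Real.exp (2 * μ L + 1) * (αPi L * KP L) * (2 * (1 + 1 / μ L)) ^ 3) * (3 * (2 * (1 + 2 / μ L)) ^ 3) * (3 * (2 * (1 + 4 / μ L)) ^ 3) = αPi L * M L := by
      simp only [hMd]; ring
    rw [e]
    calc αPi L * M L ≤ (M L + 1)⁻¹ * M L := mul_le_mul_of_nonneg_right (hαPiM L) hM
      _ < 1 := by rw [inv_mul_lt_iff₀ (by linarith)]; linarith
  refine ⟨αPi, fun L => (1 / (1 - CK L * (9600 * Real.exp (2 * μ L + 1) * (αPi L * KP L) * (2 * (1 + 1 / μ L)) ^ 3) * (3 * (2 * (1 + 2 / μ L)) ^ 3) * (3 * (2 * (1 + 4 / μ L)) ^ 3)))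
      * CK L * (3 * (2 * (1 + 8 / μ L)) ^ 3), fun L => μ L / 8, hαPi0, hW12, hW10, hW13,
    fun L hL => (hαPiK L).trans (hαK1 L hL), fun L hL => ?_, fun L hL => by have := hμ0 L hL; positivity, ?_⟩
  · have := hCK L hL; have := hμ0 L hL; have h1 := hwin L hL
    exact mul_nonneg (mul_nonneg (div_nonneg one_pos.le (by linarith)) (hCK L hL)) (by positivity)
  intro L hL i U₀ ρ hreg hρ hlift hroom a ha₀a ha₁a y Z y'
  -- the clamped coupling function
  obtain ⟨af, haf⟩ : ∃ f : ∀ L' : ℕ, Idx L' → ℝ, ∀ (L' : ℕ) (i' : Idx L'),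
      f L' i' = max (a₀ * (c₀ L' / cB L') * ((i'.1.1.L : ℝ) ^ (i'.1.2.2 - i'.1.2.1)) ^ 3) (min a (a₁ * (c₀ L' / cB L') * ((i'.1.1.L : ℝ) ^ (i'.1.2.2 - i'.1.2.1)) ^ 3)) :=
    ⟨_, fun _ _ => rfl⟩
  have ht0 : ∀ (L' : ℕ) (i' : Idx L'), 0 ≤ (c₀ L' / cB L') * ((i'.1.1.L : ℝ) ^ (i'.1.2.2 - i'.1.2.1)) ^ 3 := fun L' i' =>
    mul_nonneg (div_nonneg (hc₀ L').out.le (hcB L').out.le) (pow_nonneg (pow_nonneg (Nat.cast_nonneg _) _) _)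
  have haf_lo : ∀ (L' : ℕ) (i' : Idx L'), a₀ * (c₀ L' / cB L') * ((i'.1.1.L : ℝ) ^ (i'.1.2.2 - i'.1.2.1)) ^ 3 ≤ af L' i' := fun L' i' => by rw [haf]; exact le_max_left _ _
  have haf_hi : ∀ (L' : ℕ) (i' : Idx L'), af L' i' ≤ a₁ * (c₀ L' / cB L') * ((i'.1.1.L : ℝ) ^ (i'.1.2.2 - i'.1.2.1)) ^ 3 := fun L' i' => by
    rw [haf]
    refine max_le ?_ (min_le_right _ _)
    have := ht0 L' i'
    rw [mul_assoc, mul_assoc]; exact mul_le_mul_of_nonneg_right ha₀₁ this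
  have hafa : af L i = a := by rw [haf, min_eq_left ha₁a, max_eq_right ha₀a]
  -- the thread
  obtain ⟨Λ, hΛ⟩ : ∃ Λ : ∀ (L' : ℕ) (i' : Idx L'), GaugeField (i'.1.1.P i'.1.2.2) 0 (Matrix.specialUnitaryGroup (Fin 2) ℂ) → Prop, ∀ L' i' U₀', Λ L' i' U₀' ↔
      ((∀ cf : Site (i'.1.1.P i'.1.2.2) (i'.1.2.2 - i'.1.2.1) → Matrix (Fin 2) (Fin 2) ℂ,
        (∀ e' : PBond (i'.1.1.P i'.1.2.2) (i'.1.2.2 - i'.1.2.1), cf e'.src = ((emlIterU (i'.1.2.2 - i'.1.2.1) (bgUnits i'.1.1 i'.1.2.2 U₀') e' : (Matrix (Fin 2) (Fin 2) ℂ)ˣ) : Matrix (Fin 2) (Fin 2) ℂ) * cf e'.tgt *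
        (((emlIterU (i'.1.2.2 - i'.1.2.1) (bgUnits i'.1.1 i'.1.2.2 U₀') e')⁻¹ : (Matrix (Fin 2) (Fin 2) ℂ)ˣ) : Matrix (Fin 2) (Fin 2) ℂ)) →
        ∃ l₀ : Site (i'.1.1.P i'.1.2.2) 0 → Matrix (Fin 2) (Fin 2) ℂ,
        (∀ b' : PBond (i'.1.1.P i'.1.2.2) 0, l₀ b'.src = ((bgUnits i'.1.1 i'.1.2.2 U₀' b' : (Matrix (Fin 2) (Fin 2) ℂ)ˣ) : Matrix (Fin 2) (Fin 2) ℂ) * l₀ b'.tgt * (((bgUnits i'.1.1 i'.1.2.2 U₀' b')⁻¹ : (Matrix (Fin 2) (Fin 2) ℂ)ˣ) : Matrix (Fin 2) (Fin 2) ℂ)) ∧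
        ∀ y : Site (i'.1.1.P i'.1.2.2) (i'.1.2.2 - i'.1.2.1), l₀ (embIter (i'.1.2.2 - i'.1.2.1) y) = cf y) ∧
      2 * (12 * i'.1.1.L ^ (i'.1.2.2 - i'.1.2.1) + 5) ≤ (i'.1.1.P i'.1.2.2).sitesPerDir 0) := ⟨_, fun _ _ _ => Iff.rfl⟩
  -- the window of record at each member under the cap (for `posOnto_of_coercive`)
  have hw13 : ∀ (L' : ℕ), 1 < L' → ∀ (i' : Idx L') (ρ' : ℝ), ρ' ≤ αPi L' → 13 * 10 ^ 14 * (i'.1.1.L : ℝ) ^ 3 * ρ' ≤ 1 := by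
    intro L' hL' i' ρ' hρ'
    have e : (i'.1.1.L : ℝ) = (L' : ℝ) := by rw [i'.2.1]
    have hL0 : (0 : ℝ) < L' := by exact_mod_cast lt_trans zero_lt_one hL'
    rw [e]
    calc 13 * 10 ^ 14 * (L' : ℝ) ^ 3 * ρ' ≤ 13 * 10 ^ 14 * (L' : ℝ) ^ 3 * αPi L' := mul_le_mul_of_nonneg_left hρ' (by positivity)
      _ ≤ 1 := hW13 L' hL'
  -- the cone
  have key := kinvRow_slot_family_of_cone αPi hαPi0 hW10 hW12 c₀ cB af
    (fun L' i' => DeltaOneP i'.1.1 i'.1.2.1 i'.1.2.2 i'.2.2.le (c₀ L') (cB L') (af L' i') (TJSlotP i'.1.1 i'.1.2.1 i'.1.2.2 i'.2.2.le (c₀ L') (cB L') (af L' i'))) Λ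
    (fun L' hL' i' U₀' ρ' hreg' hρ' hl' => posOnto_of_coercive i'.2.2.le (cB L') i'.2.2 hreg' (hw13 L' hL' i' ρ' hρ') (hγco L' hL') _
      (hco L' hL' i' U₀' ρ' hreg' (hρ'.trans (hαPico L')) ((hΛ L' i' U₀').mp hl').1 (af L' i') (haf_lo L' i')))
    (fun L' hL' i' U₀' ρ' hreg' hρ' hl' =>
      (hcp L' hL' i' U₀' ρ' hreg' (hρ'.trans (hαPicp L')) ((hΛ L' i' U₀').mp hl').1 ((hΛ L' i' U₀').mp hl').2 (af L' i') (haf_lo L' i') (haf_hi L' i')).2.1)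
    CK μ (fun L' => αPi L' * KP L') δP hCK hμ0 (fun L' hL' => mul_nonneg (hαPi0 L' hL').le (hKP L' hL')) hμδ
    (fun L' hL' i' U₀' ρ' hreg' hρ' hl' => coarseRow_mono_rate i'.2.2.le (cB L') _
      (mul_nonneg (hCK L' hL') (by have hL0 : (0 : ℝ) < L' := Nat.cast_pos.mpr (lt_trans zero_lt_one hL'); have := (hc₀ L').out; have := (hcB L').out; positivity)) (hμK' L')
      (hKη L' hL' i' U₀' ρ' hreg' (hρ'.trans (hαPiK L')) ((hΛ L' i' U₀').mp hl').1 ((hΛ L' i' U₀').mp hl').2 (af L' i') (haf_lo L' i') (haf_hi L' i')))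
    (fun L' hL' i' U₀' ρ' hreg' hρ' hl' => (hP L' hL' i' U₀' ρ' hreg' (hρ'.trans (hαPiP L')) ((hΛ L' i' U₀').mp hl').1 ((hΛ L' i' U₀').mp hl').2
      (af L' i') (haf_lo L' i') (haf_hi L' i')).2.2 (αPi L') (hαPi0 L' hL') (hαPiP L') (regPr_mono (F := i'.1.1) hρ' hreg'))
    hwin L hL i U₀ ρ hreg hρ ((hΛ L i U₀).mpr ⟨hlift, hroom⟩) y Z y'
  rw [hafa] at key
  exact key


/-- ★★ **THE SAME ROW AT `DeltaOnePJ … a`** (S47's `norm_G` slot spelling; ✓`DeltaOnePJ_def` is `rfl`). [cite: Balaban1985BackgroundPropagators, (3.127)–(3.128) p.421] -/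
theorem kinvRow_one_family_exists' [hFL : ∀ F : T3Family, Fact (0 < (F.L : ℝ))] [hFη : ∀ (F : T3Family) (k : ℕ), Fact (0 < ((F.L : ℝ)⁻¹) ^ k)]
    (c₀ cB : ℕ → ℝ) [hc₀ : ∀ L : ℕ, Fact (0 < c₀ L)] [hcB : ∀ L : ℕ, Fact (0 < cB L)] {a₀ a₁ : ℝ} (ha₀ : 0 < a₀) (ha₀₁ : a₀ ≤ a₁)
    (αq qG : ℕ → ℝ) (hαq : ∀ L : ℕ, 1 < L → 0 < αq L) (hqG : ∀ L : ℕ, 1 < L → 0 ≤ qG L)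
    (hqGrow : ∀ (L : ℕ), 1 < L → ∀ (i : Idx L) (U₀ : GaugeField (i.1.1.P i.1.2.2) 0 (Matrix.specialUnitaryGroup (Fin 2) ℂ)), RegPr i.1.1 i.1.2.1 i.1.2.2 (αq L) U₀ →
      ∀ (X' : PBond (i.1.1.P i.1.2.2) 0 → Matrix (Fin 2) (Fin 2) ℂ) (s : ℝ) (x : Site (i.1.1.P i.1.2.2) 0) (A : Matrix (Fin 2) (Fin 2) ℂ), (∀ b, ‖X' b‖ ≤ s) →
        ∑ y : PBond (i.1.1.P i.1.2.1) 0, ‖avgHess i.1.1 i.1.2.1 i.1.2.2 i.2.2.le U₀ X'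
            ((toL2 i.1.1 i.1.2.2 (c₀ L)).symm (DL2 i.1.1 i.1.2.1 i.1.2.2 (c₀ L) U₀ (toL2S i.1.1 i.1.2.2 (c₀ L) (Pi.single x A)))) y‖
          ≤ qG L * ((L : ℝ) ^ (i.1.2.2 - i.1.2.1))⁻¹ * s * ‖A‖) :
    ∃ (αPi CPi μPi : ℕ → ℝ),
      (∀ L : ℕ, 1 < L → 0 < αPi L) ∧ (∀ L : ℕ, 1 < L → 10 ^ 12 * (L : ℝ) ^ 3 * αPi L ≤ 1) ∧ (∀ L : ℕ, 1 < L → 10 ^ 10 * (L : ℝ) ^ 6 * αPi L ≤ 1) ∧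
      (∀ L : ℕ, 1 < L → 13 * 10 ^ 14 * (L : ℝ) ^ 3 * αPi L ≤ 1) ∧ (∀ L : ℕ, 1 < L → αPi L ≤ 1) ∧ (∀ L : ℕ, 1 < L → 0 ≤ CPi L) ∧ (∀ L : ℕ, 1 < L → 0 < μPi L) ∧
    ∀ (L : ℕ), 1 < L → ∀ (i : Idx L) (U₀ : GaugeField (i.1.1.P i.1.2.2) 0 (Matrix.specialUnitaryGroup (Fin 2) ℂ)), ∀ ρ : ℝ, RegPr i.1.1 i.1.2.1 i.1.2.2 ρ U₀ → ρ ≤ αPi L →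
        (∀ cf : Site (i.1.1.P i.1.2.2) (i.1.2.2 - i.1.2.1) → Matrix (Fin 2) (Fin 2) ℂ,
        (∀ e' : PBond (i.1.1.P i.1.2.2) (i.1.2.2 - i.1.2.1), cf e'.src = ((emlIterU (i.1.2.2 - i.1.2.1) (bgUnits i.1.1 i.1.2.2 U₀) e' : (Matrix (Fin 2) (Fin 2) ℂ)ˣ) : Matrix (Fin 2) (Fin 2) ℂ) * cf e'.tgt *
        (((emlIterU (i.1.2.2 - i.1.2.1) (bgUnits i.1.1 i.1.2.2 U₀) e')⁻¹ : (Matrix (Fin 2) (Fin 2) ℂ)ˣ) : Matrix (Fin 2) (Fin 2) ℂ)) →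
        ∃ l₀ : Site (i.1.1.P i.1.2.2) 0 → Matrix (Fin 2) (Fin 2) ℂ,
        (∀ b' : PBond (i.1.1.P i.1.2.2) 0, l₀ b'.src = ((bgUnits i.1.1 i.1.2.2 U₀ b' : (Matrix (Fin 2) (Fin 2) ℂ)ˣ) : Matrix (Fin 2) (Fin 2) ℂ) * l₀ b'.tgt * (((bgUnits i.1.1 i.1.2.2 U₀ b')⁻¹ : (Matrix (Fin 2) (Fin 2) ℂ)ˣ) : Matrix (Fin 2) (Fin 2) ℂ)) ∧
        ∀ y : Site (i.1.1.P i.1.2.2) (i.1.2.2 - i.1.2.1), l₀ (embIter (i.1.2.2 - i.1.2.1) y) = cf y) →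
      2 * (12 * i.1.1.L ^ (i.1.2.2 - i.1.2.1) + 5) ≤ (i.1.1.P i.1.2.2).sitesPerDir 0 →
      ∀ a : ℝ, a₀ * (c₀ L / cB L) * ((i.1.1.L : ℝ) ^ (i.1.2.2 - i.1.2.1)) ^ 3 ≤ a → a ≤ a₁ * (c₀ L / cB L) * ((i.1.1.L : ℝ) ^ (i.1.2.2 - i.1.2.1)) ^ 3 →
      ∀ (y : PBond (i.1.1.P i.1.2.1) 0) (Z : Matrix (Fin 2) (Fin 2) ℂ) (y' : PBond (i.1.1.P i.1.2.1) 0),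
        ‖(toL2B i.1.1 i.1.2.1 (cB L)).symm (KinvT i.1.1 i.1.2.1 i.1.2.2 i.2.2.le (c₀ L) (cB L) a (DeltaOnePJ i.1.1 i.1.2.1 i.1.2.2 i.2.2.le (c₀ L) (cB L) a) U₀
            (toL2B i.1.1 i.1.2.1 (cB L) (Pi.single y Z))) y'‖
          ≤ CPi L * ((c₀ L / cB L) * ((L : ℝ) ^ (i.1.2.2 - i.1.2.1)) ^ 3)
              * Real.exp (-(μPi L * (Site.tdist (siteShift (sites_eq i.1.1 i.1.2.1 i.1.2.2 i.2.2.le) y'.src) (siteShift (sites_eq i.1.1 i.1.2.1 i.1.2.2 i.2.2.le) y.src) : ℝ))) * ‖Z‖ :=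
  kinvRow_one_family_exists c₀ cB ha₀ ha₀₁ αq qG hαq hqG hqGrow

end Summit.QuantumFields.YangMills.Theorems.Prop7KinvOneFamilyPackage

end
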